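import Literature.MathematicalPhysics.QuantumFieldTheory.Balaban1983to89.B9Cor36GCubeWindowsPointwise
import Literature.MathematicalPhysics.QuantumFieldTheory.Balaban1983to89.B9Ineq373HessianPieceBoundsY
import Literature.MathematicalPhysics.QuantumFieldTheory.Balaban1983to89.B9Cor35GCubeAvgPiece

/-!
# `Balaban1983to89.B9Cor36GCubeWindows` — [B9] COR. 3.6 p. 408 ∕ (3.37) p. 396 ∕ (3.69)–(3.73) pp. 404–405 FOR THE CUBE CONFIGURATION `Ṽ_□ = e^{iηχ̃_□A}`:
# THE THREE SMALL-FIELD WINDOWS AND THE ι-CENTRED SMALLNESS OF THE BOND-SECTOR `G_□`-ROAD, DISCHARGED FROM THE (3.35) CUBE DATUM — the `hW1`∕`hW2`∕`hW3`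
# hypotheses of `B9Ineq373HessianPieceBoundsY.hasMajorant_V0Y`∕`hasMajorant_V1Y` and the `hsm` hypothesis of `B9Cor35GCubeAvgPiece.hasMajorant_avgPieceK` at
# `V := locCfgY i □ η A`, with ONE explicit constant `α₁ = α_W(s)`, `s = max C (C(1+D₁θ))·Λ²` (p33's site-sector `α₁`), and the realified `hV0`∕`hV1 ν`∕`hAv` inputs of
# `B9Cor35GAtCubeLetters.cor35_G_cube_of_pieces` at `Ṽ_□` (sub-row G-B9-LETTERS, module M5.1b-G, smallness bridge part II)

T. Bałaban, *Propagators for lattice gauge theories in a background field*, Commun. Math. Phys. **99** (1985) 389–434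
[`Balaban1985BackgroundPropagators`, "B9"]; [4] = Commun. Math. Phys. **96** (1984) 223–250 [`Balaban1984PropagatorsII`].

statement-level skeleton of published theorems with citation tags; proofs where landed; nothing here is a claim about the
Yang–Mills mass gap

THE PRINTED LOCUS (held `paper:balaban1985-cmp99-background-propagators`, journal page = PDF page + 388; page owner r06).  p. 408 Cor. 3.6 l. 3–6: *«Applying
the gauge transformation u we get U′ = U^u = e^{iηA} with A satisfying the inequalities in (3.35) for j = k. This implies that U′ satisfies (3.37) for the sequence
{Ω′_j} with U = 1 and α₁ = O(1)Mα₀. Assuming O(1)Mα₀ ≦ a₁ we can apply the above Corollary»*; p. 396 (3.35) *«there exists a gauge transformation u on □ such that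
U^u = e^{iηA} … |A| < O(1)Mα₀(Lʲη)⁻¹, |∇^ηA| < O(1)Mα₀(Lʲη)⁻² on □»* (with `U`, `u` `G`-valued, so `e^{iηA} ∈ G`), (3.37) *«|A′| < α₁(Lʲη)⁻¹, |∇^η_UA′| < α₁(Lʲη)⁻²
on Ω_j»*; p. 404 below (3.69): *«the estimates [on Re U′U(∂p) − 1, Im U′U(∂p)] follow directly from the assumptions (3.35), (3.37)»*; (3.70)–(3.73) pp. 404–405
(the `|A|`, `|A|²` and `|∇A|` norms *«determined by the set st(b)»*); (3.83) p. 407 (the averaging piece, «|U′U(Γ) − U(Γ)| ≦ |Γ|·sup|ηA|» level by level).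

WHY THIS FILE (cell `lit-balaban`, sub-row G-B9-LETTERS; module M5.1b-G = Cor. 3.5∕3.6 for the BOND-sector cube letter `G_□ = Δ_{a,□}⁻¹`).  The assembly
`B9Cor35GAtCubeLetters.cor35_G_cube_of_pieces` (G-F5, p645320) takes the Laplacian piece as `hLap` + `hV0` + `hV1 ν` and the averaging piece as `hAv`; G-F5a III
(`B9Ineq373HessianPieceBoundsY`, p649571) proved `hV0`∕`hV1` from THREE WINDOWS on the configuration `V` in the block-neighbourhood form `dSite i □ a y ≤ 2` at
scale `η∕len(a)` — (W1) `‖V − 1‖ ≤ α₁η∕len(a)`, (W2) `‖V(y) − V(y − e_μ)‖ ≤ α₁(η∕len(a))²`, (W3) `‖Re V(∂p) − 1‖, ‖Im V(∂p)‖ ≤ α₁(η∕len(a))²` — plus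
bi-contractivity of `V`; G-F5c (`B9Cor35GCubeAvgPiece`, p644566) proved `hAv` from the ι-centred smallness `hsm` (`‖V − 1‖ ≤ α₁L^{−J}` within `(d+2)(Lᴶ − 1)` of
every level-`J` index bond); bridge part I (`B9Cor36GCubeWindowsPointwise`, p650481) proved the three windows AT A POINT from local readings of `Ã = χ̃_□A`.  THIS
FILE closes the bridge for Cor. 3.6's cube configuration `Ṽ_□ = locCfgY i □ η A = e^{iηχ̃_□A}`: p33's `B9Cor36CubeCutoffs.readings337_locFld` (the (3.37)-readings
of `chartA (χ̃_□A)` against ANY admissible length `0 < λ ≤ Λξ`, constant `s = max C (C(1+D₁θ))·Λ²`) is read at a CONSTANT length — the cube block's own `len(a) =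
Lⁿη` for the windows, the index bond's `Lᴶη` for `hsm` (both `≤ L^{j+1}η ≤ Λξ`, the cube sequence having levels `≤ j + 1`) — so every window holds UNIFORMLY in the
point (the `dSite ≤ 2` premise is not needed and bridge I's level-slack lemma is not used), with the single constant `α_W(s) = e^{6s}(2s + 18s²)` (`≥ s·e^{s}`,
`= O(s)` as `s → 0`: print's «α₁ = O(1)Mα₀»).  Bi-contractivity of `Ṽ_□` is NOT derivable from `Reg335Cube` as typed (no `𝔤`-valuedness of `A` in an abstract
Banach algebra); it is derived here from the HERMITIAN-TYPE hypothesis `hAu : ∀ t κ x, ‖e^{itA_κ(x)}‖ ≤ 1` (print: `U`, `u` are `G`-valued, so `A ∈ 𝔤` and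
`e^{iηχ̃A} ∈ G`), which is the displayed input replacing `hU`.

WHAT THIS FILE PROVES (THEOREMS + two real constants with bodies `sRead C Λ := max C (C(1+D₁θ))·Λ²`, `alphaW s := e^{6s}(2s + 18s²)`; 0 `def … : Prop`, 0 sorry).
§1 `sRead`, `sRead_nonneg`, `alphaW`, `alphaW_nonneg`, `mul_exp_le_alphaW` (`s·e^{s} ≤ α_W(s)`), `exp_mul_le_alphaW`; §2 ★ `readings_at_scale` (at any `0 < λ ≤ Λξ`:
`‖Ã_κ(y)‖ ≤ s∕λ` and `‖Ã_κ(y + e_μ) − Ã_κ(y)‖ ≤ ηs∕λ²` for ALL torus sites `y`, from `readings337_locFld` with `len := λ` through def-Y's chart), `len_blkCubeY_le_scaleLen`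
(`len(a) ≤ L^{j+1}η`), `lvl_ibond_le` (`J(ι) ≤ j + 1`); §3 ★ `norm_locCfgY_sub_one_le` (W1 at scale `λ ≥ η`: `≤ s·e^{s}·η∕λ`), ★ `norm_locCfgY_sub_unshift_le` (W2:
`≤ s·e^{s}·(η∕λ)²`), ★ `norm_holY_locCfgY_sub_one_le` (W3: `≤ α_W(s)(η∕λ)²`), `unitaryLike_locCfgY` (bi-contractivity of `Ṽ_□` from `hAu`), `unitaryLike_holY`,
`norm_reHolY_imHolY_locCfgY_le`; §4 ★★★ THE BINDERS VERBATIM at `V := locCfgY i □ (kGeo i).eta A`, `α₁ := alphaW (sRead C Λ)`: `hW1_locCfgY`, `hW2_locCfgY`,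
`hW3_locCfgY`, `hsm_locCfgY`; §5 ★★★ REALIFIED: `hasMajorant_V1Y_locCfgY`, `hasMajorant_V0Y_locCfgY` (under `α_W(s) ≤ 1`), `hasMajorant_avgPieceK_locCfgY` — the
`hV1 ν`, `hV0`, `hAv` inputs of `cor35_G_cube_of_pieces` at `Ṽ_□` from the (3.35) cube datum in p33's unpacked form.

HONEST SCOPE.  Bookkeeping over landed modules (p33's `readings337_locFld` ∕ cube geometry, bridge I, G-F5a III, G-F5c) — all BY NAME; nothing of [B9]'s analysis is
asserted.  DISPLAYED (hypotheses, not proved here): the (3.35) cube datum in p33's unpacked form (`|A| ≤ Cξ⁻¹`, `|η⁻¹∂A| ≤ Cξ⁻²` on a torus set `Q ⊇ NearC(4.375S_j + 1)`,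
`ξ ≤ 5S_jη`, `L^{j+1}η ≤ Λξ`, `Λ ≥ 1`), the Hermitian type of `A` (`hAu`), `NormOneClass 𝔸`, a real basis with coordinate constant `M₂`, the weight band `0 < b₀ ≤ b₁`,
and for `hV0` the smallness `α_W(s) ≤ 1` («O(1)Mα₀ sufficiently small»).  The projection piece (G-F5b), the instantiation of `cor35_G_cube_of_pieces` and Cor. 3.6's
`hE` (G-F6) are NOT here.  Count-neutral; NOT a node discharge; no summit ∕ sub-problem statement is proved; nothing continuum ∕ OS ∕ mass-gap ∕ Clay; YM mass gap NOT
proved by any of this (Track A conditional rung).  No `sorry`, no `axiom`, no `… : Prop` fact, no `instance`, no `notation`.  NEW file; nothing landed is modified.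
Cell `lit-balaban`, seat `lit-balaban-p38` gen 43, 2026-08-28; `--supports stmt-QuantumFields-19200` as helper.  Net new unproved facts: 0.

RELATED IN THE TREE, NOT DUPLICATED: bridge I `B9Cor36GCubeWindowsPointwise` (pointwise windows, USED), p33's `B9Cor36CubeCutoffs.readings337_locFld` (USED) and the
site-sector road `B9Cor36GpCubeIsUnit`∕`B9Cor36GpCubeExtAtV` (no unitarity needed at the base `1`; the bond sector's transporters need it), r05's
`B9Eq358TaxiLettersY.norm_fluct_sub_one_le`, G-F5a III ∕ G-F5c (the consumers, instantiated in §5).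
-/

noncomputable section

namespace Literature.MathematicalPhysics.QuantumFieldTheory.Balaban1983to89.B9Cor36GCubeWindows

open NormedSpace Complex
open Node00
open Literature.MathematicalPhysics.QuantumFieldTheory.Balaban1983to89
open Literature.MathematicalPhysics.QuantumFieldTheory.Balaban1983to89.B6RandomWalk (HasMajorant)
open Literature.MathematicalPhysics.QuantumFieldTheory.Balaban1983to89.B9Thm34Ext (toB6)
open Literature.MathematicalPhysics.QuantumFieldTheory.Balaban1983to89.B4PartitionUnity22 (thetaProf D1 D1_nonneg contDiff_thetaProf hasCompactSupport_thetaProf)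
open Literature.MathematicalPhysics.QuantumFieldTheory.Balaban1983to89.B6KLevelCensusIndexV1 (KIdx kGeo)
open Literature.MathematicalPhysics.QuantumFieldTheory.Balaban1983to89.B6GlobalChartV1 (PV boxEquiv)
open Literature.MathematicalPhysics.QuantumFieldTheory.Balaban1983to89.B6Cover236MultiLevelBlocks (cubes)
open Literature.MathematicalPhysics.QuantumFieldTheory.Balaban1983to89.B15DeterminingSets (embIter)
open Literature.MathematicalPhysics.QuantumFieldTheory.Balaban1983to89.B9Eq39Adjoint (prodCfg fluct covD)
open Literature.MathematicalPhysics.QuantumFieldTheory.Balaban1983to89.B9BackgroundsKLevelV1 (shiftsV1)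
open Literature.MathematicalPhysics.QuantumFieldTheory.Balaban1983to89.B9Cor36CubeCutoffs (SC NearC locCfgY locCfgY_apply chiTY readings337_locFld)
open Literature.MathematicalPhysics.QuantumFieldTheory.Balaban1983to89.B9Cor36CutoffField337 (cutFldY covD_one_apply)
open Literature.MathematicalPhysics.QuantumFieldTheory.Balaban1983to89.B9Eq360DeltaPrimeAY (AfldY chartA chartA_apply)
open Literature.MathematicalPhysics.QuantumFieldTheory.Balaban1983to89.B9Eq369Product (val_fluct val_inv_fluct)
open Literature.MathematicalPhysics.QuantumFieldTheory.Balaban1983to89.B9CubeLettersOpsL0 (cubeFamY levCubeY)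
open Literature.MathematicalPhysics.QuantumFieldTheory.Balaban1983to89.B9CubeLettersBondOpsL0 (BlkCubeY IBondCubeY blkCornerCubeY)
open Literature.MathematicalPhysics.QuantumFieldTheory.Balaban1983to89.B9Eq360DeltaPrimeACubeY (blkCubeY)
open Literature.MathematicalPhysics.QuantumFieldTheory.Balaban1983to89.B9CubeGeometryInputs (geoCK geoCK_len geoCK_len_pos geoCK_eta geoCK_eta_pos geoCK_eta_le_len
  geoCK_len_blkCubeY)
open Literature.MathematicalPhysics.QuantumFieldTheory.Balaban1983to89.B9CubeSequence408 (lev_cubeFam_le_succ)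
open Literature.MathematicalPhysics.QuantumFieldTheory.Balaban1983to89.B9Cor36GCubeWindowsPointwise (locCfgY_eq_prodCfg norm_prodCfg_one_sub_one_le
  norm_prodCfg_one_sub_le norm_holY_prodCfg_sub_one_le norm_reHolY_imHolY_le)
open Literature.MathematicalPhysics.QuantumFieldTheory.Balaban1983to89.B9Eq371CoCurlLeibnizY (V0Y V1Y)
open Literature.MathematicalPhysics.QuantumFieldTheory.Balaban1983to89.B9Ineq373HessianPieceBoundsY (dSite cV0 cV1 hasMajorant_V0Y hasMajorant_V1Y)
open Literature.MathematicalPhysics.QuantumFieldTheory.Balaban1983to89.B9Cor35GCubeInputsAtOne (blkBK)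
open Literature.MathematicalPhysics.QuantumFieldTheory.Balaban1983to89.B9Cor35GCubeAvgPiece (avgPieceK kappaAv hasMajorant_avgPieceK)
open Literature.MathematicalPhysics.QuantumFieldTheory.Balaban1983to89.T4RelativeLadder (UnitaryLike)
open Literature.MathematicalPhysics.QuantumFieldTheory.Balaban1983to89.Node00.OpsYNablaBridge (chartY shiftY_chartY shift_unshift)

variable {d ℓ : ℕ} {hd : 1 ≤ d + 1} {hL : Odd (ℓ + 1) ∧ 1 < ℓ + 1} {b₀ b₁ : ℝ}

/-! ## §1  The two constants: p33's reading constant `s = max C (C(1+D₁θ))·Λ²` and the window constant `α_W(s) = e^{6s}(2s + 18s²)` -/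

/-- **p33's (3.37)-reading constant** of the cube's cut-off field: `s := max C (C(1 + D₁θ))·Λ²` (`C = O(1)Mα₀` of (3.35), `Λ` the length slack `L^{j+1}η ≤ Λξ`,
`D₁θ = sup|θ′|` of [4-I]'s profile) — print's «α₁ = O(1)Mα₀» of Cor. 3.6. [cite: Balaban1985BackgroundPropagators, Cor. 3.6 p.408, (3.35)∕(3.37) p.396] -/
def sRead (C Λ : ℝ) : ℝ := max C (C * (1 + D1 thetaProf)) * Λ ^ 2

/-- `s ≥ 0` for `C ≥ 0`. [cite: Balaban1985BackgroundPropagators, Cor. 3.6 p.408, bookkeeping] -/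
theorem sRead_nonneg {C : ℝ} (hC : 0 ≤ C) (Λ : ℝ) : 0 ≤ sRead C Λ := by
  unfold sRead; exact mul_nonneg (le_max_of_le_left hC) (sq_nonneg _)

/-- **THE WINDOW CONSTANT `α_W(s) := e^{6s}(2s + 18s²)`** — r06's second-order plaquette constant at `c = s`, which dominates the first-order `s·e^{s}` of the bond
and variation windows; `O(s)` as `s → 0`. [cite: Balaban1985BackgroundPropagators, (3.69) p.404, (3.37) p.396, bookkeeping] -/
def alphaW (s : ℝ) : ℝ := Real.exp (6 * s) * (2 * s + 18 * s ^ 2)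

/-- `α_W(s) ≥ 0` for `s ≥ 0`. [cite: Balaban1985BackgroundPropagators, (3.69) p.404, bookkeeping] -/
theorem alphaW_nonneg {s : ℝ} (hs : 0 ≤ s) : 0 ≤ alphaW s := by
  unfold alphaW; positivity

/-- `s·e^{s} ≤ α_W(s)`. [cite: Balaban1985BackgroundPropagators, (3.69) p.404, bookkeeping] -/
theorem mul_exp_le_alphaW {s : ℝ} (hs : 0 ≤ s) : s * Real.exp s ≤ alphaW s := by
  unfold alphaW
  have h1 : Real.exp s ≤ Real.exp (6 * s) := Real.exp_le_exp.2 (by linarith)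
  have h2 : s ≤ 2 * s + 18 * s ^ 2 := by nlinarith [sq_nonneg s]
  calc s * Real.exp s ≤ (2 * s + 18 * s ^ 2) * Real.exp (6 * s) := mul_le_mul h2 h1 (Real.exp_pos _).le (by positivity)
    _ = Real.exp (6 * s) * (2 * s + 18 * s ^ 2) := by ring

/-- `e^{6st}(2s + 18s²) ≤ α_W(s)` for `0 ≤ t ≤ 1`. [cite: Balaban1985BackgroundPropagators, (3.69) p.404, bookkeeping] -/
theorem exp_mul_le_alphaW {s t : ℝ} (hs : 0 ≤ s) (ht : t ≤ 1) :
    Real.exp (6 * s * t) * (2 * s + 18 * s ^ 2) ≤ alphaW s := by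
  unfold alphaW
  have h1 : Real.exp (6 * s * t) ≤ Real.exp (6 * s) := Real.exp_le_exp.2 (by nlinarith)
  exact mul_le_mul_of_nonneg_right h1 (by positivity)

/-! ## §2  The (3.37)-readings of `Ã = χ̃_□A` AT A CONSTANT LENGTH `λ`, on torus sites; the cube's lengths and the index bonds' levels are admissible -/

section Readings

variable {𝔸 : Type} [NormedRing 𝔸] [NormedAlgebra ℂ 𝔸] [CompleteSpace 𝔸]
variable (i : KIdx d ℓ hd hL b₀ b₁) (c : ↥(cubes (toKT i).D.toDomains))

omit [CompleteSpace 𝔸] in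
/-- ★ **THE (3.37)-READINGS OF `Ã = χ̃_□A` AT A CONSTANT LENGTH** `0 < λ ≤ Λξ`: `‖Ã_κ(y)‖ ≤ s∕λ` and `‖Ã_κ(y + e_μ) − Ã_κ(y)‖ ≤ η·s∕λ²` at EVERY torus site `y`
(p33's `readings337_locFld` with `len := λ`, read back through def-Y's chart). [cite: Balaban1985BackgroundPropagators, Cor. 3.6 p.408, (3.35)∕(3.37) p.396] -/
theorem readings_at_scale {A : AfldY 𝔸 i} {Q : Set (Site (PV d ℓ i.m i.K hd hL) 0)} {C ξ Λ : ℝ} (hC : 0 ≤ C) (hξ : 0 < ξ) (hΛ : 1 ≤ Λ)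
    (hξS : ξ ≤ 5 * (SC i c : ℝ) * (kGeo i).eta)
    (hQ : ∀ x : Site (PV d ℓ i.m i.K hd hL) 0, NearC i c (35 * SC i c / 8 + 1) (boxEquiv i.hN x).1 → x ∈ Q)
    (hA : ∀ κ, ∀ x ∈ Q, ‖A κ x‖ ≤ C * ξ⁻¹)
    (hdA : ∀ μ ν, ∀ x ∈ Q, ‖(((kGeo i).eta : ℂ)⁻¹) • covD (shiftsV1 (PV d ℓ i.m i.K hd hL)) (fun _ _ => (1 : 𝔸ˣ)) μ (A ν) x‖ ≤ C * (ξ ^ 2)⁻¹)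
    {lam : ℝ} (hlam0 : 0 < lam) (hlam : lam ≤ Λ * ξ) :
    (∀ (κ : Fin (d + 1)) (y : Site (PV d ℓ i.m i.K hd hL) 0), ‖cutFldY i (chiTY i c) A κ y‖ ≤ sRead C Λ * lam⁻¹) ∧
    (∀ (μ κ : Fin (d + 1)) (y : Site (PV d ℓ i.m i.K hd hL) 0),
      ‖cutFldY i (chiTY i c) A κ (y.shift μ) - cutFldY i (chiTY i c) A κ y‖ ≤ (kGeo i).eta * (sRead C Λ * (lam ^ 2)⁻¹)) := by
  have hη := (B9BackgroundsKLevelV1.eta_pos_L_one_le_M_pos i).1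
  obtain ⟨-, h2, -, h4, -⟩ := readings337_locFld i c hC hη hξ hΛ hξS hQ hA hdA (fun _ => lam) (fun _ => hlam0) (fun _ => hlam)
  refine ⟨fun κ y => ?_, fun μ κ y => ?_⟩
  · have h := h4 κ (chartY i y)
    rw [chartA_apply] at h
    change ‖cutFldY i (chiTY i c) A κ ((boxEquiv i.hN).symm (boxEquiv i.hN y))‖ ≤ _ at h
    rwa [Equiv.symm_apply_apply] at h
  · have h := h2 μ κ (chartY i y)
    rw [B9Cor36CutoffField337.covD_one_chartA, covD_one_apply] at h
    change ‖(((kGeo i).eta : ℂ)⁻¹) • (cutFldY i (chiTY i c) A κ (shiftsV1 (PV d ℓ i.m i.K hd hL) μ ((boxEquiv i.hN).symm (boxEquiv i.hN y))) -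
      cutFldY i (chiTY i c) A κ ((boxEquiv i.hN).symm (boxEquiv i.hN y)))‖ ≤ _ at h
    rw [Equiv.symm_apply_apply, norm_smul, norm_inv, Complex.norm_real, Real.norm_eq_abs, abs_of_pos hη] at h
    have e : shiftsV1 (PV d ℓ i.m i.K hd hL) μ y = y.shift μ := rfl
    rw [e] at h
    have h' := mul_le_mul_of_nonneg_left h hη.le
    rwa [← mul_assoc, mul_inv_cancel₀ hη.ne', one_mul] at h'

/-- the cube sequence's block lengths are `≤ L^{j+1}η` (levels `≤ j + 1`). [cite: Balaban1985BackgroundPropagators, p.408 («{Ω_n(□)}_{n=0,…,j+1}»), (3.41) p.397] -/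
theorem len_blkCubeY_le_scaleLen (a : BlkCubeY i c) :
    (geoCK i c).len a ≤ LatticeNorms.scaleLen ((ℓ : ℝ) + 1) (kGeo i).eta (c.1.1 + 1) := by
  have e : blkCubeY i c (blkCornerCubeY i c a) = a := B6Geom246MultiLevelBoxL0.blkOf_corner (cubeFamY i c).toDomains a
  obtain ⟨h1, h2⟩ := geoCK_len_blkCubeY i c (blkCornerCubeY i c a)
  rw [e] at h1
  rw [h1, LatticeNorms.scaleLen]
  have hL1 : (1 : ℝ) ≤ (ℓ : ℝ) + 1 := by linarith [(Nat.cast_nonneg ℓ : (0 : ℝ) ≤ ℓ)]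
  exact mul_le_mul_of_nonneg_right (pow_le_pow_right₀ hL1 h2) ((B9BackgroundsKLevelV1.eta_pos_L_one_le_M_pos i).1).le

/-- the index bonds of the cube sequence have levels `≤ j + 1` (the base block `B^J(base ι)` carries fine sites of level exactly `J`).
[cite: Balaban1985BackgroundPropagators, p.408; Balaban1984PropagatorsII, (2.3)–(2.4) p.224] -/
theorem lvl_ibond_le (ι : IBondCubeY i c) : (ι.1.1 : ℕ) ≤ c.1.1 + 1 := by
  have h := B6Ineq2142KLevelV1L0.lev_eq_of_base i.hN (cubeFamY i c) i.hk ι (B6Ineq2142KLevelV1L0.iterBlockOf_baseSite i.hN (cubeFamY i c) i.hk ι)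
  have h2 := lev_cubeFam_le_succ (D := (toKT i).D) (q := c) (hL := hL.1) (hM := B9CubeLettersOpsL0.oddMh i) (hMh := (toKT i).hMh) (hP := (toKT i).hP)
    (B6GlobalChartV1.toBox i.hN (B6Ineq2142KLevelV1L0.baseSite i.hN (cubeFamY i c) i.hk ι) : Fin (d + 1) → ℤ)
  change (cubeFamY i c).lev _ ≤ c.1.1 + 1 at h2
  rw [h] at h2
  exact h2

/-- `η ≤ Lᴶη ≤ Λξ` for an index bond's level `J`. [cite: Balaban1985BackgroundPropagators, (3.41) p.397, p.408, bookkeeping] -/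
theorem scaleLen_ibond_bounds {ξ Λ : ℝ} (hΛξ : LatticeNorms.scaleLen ((ℓ : ℝ) + 1) (kGeo i).eta (c.1.1 + 1) ≤ Λ * ξ) (ι : IBondCubeY i c) :
    (kGeo i).eta ≤ (((ℓ + 1 : ℕ) : ℝ)) ^ (ι.1.1 : ℕ) * (kGeo i).eta ∧ (((ℓ + 1 : ℕ) : ℝ)) ^ (ι.1.1 : ℕ) * (kGeo i).eta ≤ Λ * ξ := by
  have hη := (B9BackgroundsKLevelV1.eta_pos_L_one_le_M_pos i).1
  have hL1 : (1 : ℝ) ≤ ((ℓ + 1 : ℕ) : ℝ) := by exact_mod_cast Nat.succ_le_succ (Nat.zero_le ℓ)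
  refine ⟨le_mul_of_one_le_left hη.le (one_le_pow₀ hL1), le_trans ?_ hΛξ⟩
  rw [LatticeNorms.scaleLen]
  push_cast
  exact mul_le_mul_of_nonneg_right (pow_le_pow_right₀ (by exact_mod_cast hL1) (lvl_ibond_le i c ι)) hη.le

end Readings

/-! ## §3  The windows of `Ṽ_□ = e^{iηχ̃_□A}` at a constant scale `η ≤ λ ≤ Λξ`, uniformly on the torus; bi-contractivity from the Hermitian type of `A` -/

section Windows

variable {𝔸 : Type} [NormedRing 𝔸] [NormedAlgebra ℂ 𝔸] [CompleteSpace 𝔸]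
variable (i : KIdx d ℓ hd hL b₀ b₁) (c : ↥(cubes (toKT i).D.toDomains))
variable {A : AfldY 𝔸 i} {Q : Set (Site (PV d ℓ i.m i.K hd hL) 0)} {C ξ Λ : ℝ} (hC : 0 ≤ C) (hξ : 0 < ξ) (hΛ : 1 ≤ Λ)
    (hξS : ξ ≤ 5 * (SC i c : ℝ) * (kGeo i).eta)
    (hQ : ∀ x : Site (PV d ℓ i.m i.K hd hL) 0, NearC i c (35 * SC i c / 8 + 1) (boxEquiv i.hN x).1 → x ∈ Q)
    (hA : ∀ κ, ∀ x ∈ Q, ‖A κ x‖ ≤ C * ξ⁻¹)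
    (hdA : ∀ μ ν, ∀ x ∈ Q, ‖(((kGeo i).eta : ℂ)⁻¹) • covD (shiftsV1 (PV d ℓ i.m i.K hd hL)) (fun _ _ => (1 : 𝔸ˣ)) μ (A ν) x‖ ≤ C * (ξ ^ 2)⁻¹)
include hC hξ hΛ hξS hQ hA hdA

section NormOne

variable [NormOneClass 𝔸]

/-- ★ **(W1) AT SCALE `λ`**: `‖Ṽ_κ(y) − 1‖ ≤ s·e^{s}·(η∕λ)` for every torus site `y`, every `η ≤ λ ≤ Λξ` («|U′ − 1| ≦ e^{η|A′|} − 1», (3.37) with `U = 1`).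
[cite: Balaban1985BackgroundPropagators, Cor. 3.6 p.408, (3.37) p.396, (3.70) p.404] -/
theorem norm_locCfgY_sub_one_le {lam : ℝ} (hηl : (kGeo i).eta ≤ lam) (hlam : lam ≤ Λ * ξ) (κ : Fin (d + 1)) (y : Site (PV d ℓ i.m i.K hd hL) 0) :
    ‖(locCfgY i c (kGeo i).eta A κ y : 𝔸) - 1‖ ≤ sRead C Λ * Real.exp (sRead C Λ) * ((kGeo i).eta * lam⁻¹) := by
  have hη := (B9BackgroundsKLevelV1.eta_pos_L_one_le_M_pos i).1
  have hlam0 : 0 < lam := lt_of_lt_of_le hη hηl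
  have hs := sRead_nonneg hC Λ
  obtain ⟨h4, -⟩ := readings_at_scale i c hC hξ hΛ hξS hQ hA hdA hlam0 hlam
  rw [locCfgY_eq_prodCfg]
  refine (norm_prodCfg_one_sub_one_le i hη.le (cutFldY i (chiTY i c) A) κ y).trans ?_
  have hb := h4 κ y
  have h1 : (kGeo i).eta * ‖cutFldY i (chiTY i c) A κ y‖ ≤ (kGeo i).eta * (sRead C Λ * lam⁻¹) := mul_le_mul_of_nonneg_left hb hη.le
  have h2 : (kGeo i).eta * (sRead C Λ * lam⁻¹) ≤ sRead C Λ := by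
    rw [show (kGeo i).eta * (sRead C Λ * lam⁻¹) = sRead C Λ * ((kGeo i).eta / lam) by ring]
    exact mul_le_of_le_one_right hs ((div_le_one hlam0).2 hηl)
  have h3 : Real.exp ((kGeo i).eta * ‖cutFldY i (chiTY i c) A κ y‖) ≤ Real.exp (sRead C Λ) := Real.exp_le_exp.2 (h1.trans h2)
  calc (kGeo i).eta * ‖cutFldY i (chiTY i c) A κ y‖ * Real.exp ((kGeo i).eta * ‖cutFldY i (chiTY i c) A κ y‖)
      ≤ (kGeo i).eta * (sRead C Λ * lam⁻¹) * Real.exp (sRead C Λ) := mul_le_mul h1 h3 (Real.exp_pos _).le (by positivity)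
    _ = sRead C Λ * Real.exp (sRead C Λ) * ((kGeo i).eta * lam⁻¹) := by ring

/-- ★ **(W2) AT SCALE `λ`**: `‖Ṽ_κ(y) − Ṽ_κ(y − e_μ)‖ ≤ s·e^{s}·(η∕λ)²` for every torus site `y`, every `η ≤ λ ≤ Λξ` (the `|∇^ηA′| < α₁(Lʲη)⁻²` reading of (3.37)).
[cite: Balaban1985BackgroundPropagators, Cor. 3.6 p.408, (3.37) p.396, (3.71) p.405] -/
theorem norm_locCfgY_sub_unshift_le {lam : ℝ} (hηl : (kGeo i).eta ≤ lam) (hlam : lam ≤ Λ * ξ) (κ μ : Fin (d + 1)) (y : Site (PV d ℓ i.m i.K hd hL) 0) :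
    ‖(locCfgY i c (kGeo i).eta A κ y : 𝔸) - locCfgY i c (kGeo i).eta A κ (y.unshift μ)‖ ≤
      sRead C Λ * Real.exp (sRead C Λ) * ((kGeo i).eta * lam⁻¹) ^ 2 := by
  have hη := (B9BackgroundsKLevelV1.eta_pos_L_one_le_M_pos i).1
  have hlam0 : 0 < lam := lt_of_lt_of_le hη hηl
  have hs := sRead_nonneg hC Λ
  obtain ⟨h4, h2⟩ := readings_at_scale i c hC hξ hΛ hξS hQ hA hdA hlam0 hlam
  have hsm : ∀ y', (kGeo i).eta * ‖cutFldY i (chiTY i c) A κ y'‖ ≤ sRead C Λ := fun y' => by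
    refine (mul_le_mul_of_nonneg_left (h4 κ y') hη.le).trans ?_
    rw [show (kGeo i).eta * (sRead C Λ * lam⁻¹) = sRead C Λ * ((kGeo i).eta / lam) by ring]
    exact mul_le_of_le_one_right hs ((div_le_one hlam0).2 hηl)
  rw [locCfgY_eq_prodCfg]
  refine (norm_prodCfg_one_sub_le i hη.le (cutFldY i (chiTY i c) A) κ y (y.unshift μ) (hsm y) (hsm _)).trans ?_
  have hd := h2 μ κ (y.unshift μ)
  rw [shift_unshift] at hd
  calc (kGeo i).eta * ‖cutFldY i (chiTY i c) A κ y - cutFldY i (chiTY i c) A κ (y.unshift μ)‖ * Real.exp (sRead C Λ)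
      ≤ (kGeo i).eta * ((kGeo i).eta * (sRead C Λ * (lam ^ 2)⁻¹)) * Real.exp (sRead C Λ) := by gcongr
    _ = sRead C Λ * Real.exp (sRead C Λ) * ((kGeo i).eta * lam⁻¹) ^ 2 := by rw [mul_pow, ← inv_pow]; ring

end NormOne

/-- ★ **(W3) AT SCALE `λ`**: `‖Ṽ(∂p) − 1‖ ≤ α_W(s)·(η∕λ)²` for every plaquette `p`, every `η ≤ λ ≤ Λξ` (bridge I's second-order plaquette bound fed with the
uniform readings). [cite: Balaban1985BackgroundPropagators, (3.69) p.404 («the estimates follow directly from the assumptions (3.35), (3.37)»), Cor. 3.6 p.408] -/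
theorem norm_holY_locCfgY_sub_one_le {lam : ℝ} (hηl : (kGeo i).eta ≤ lam) (hlam : lam ≤ Λ * ξ) (p : PlaqY i) :
    ‖(holY i (locCfgY i c (kGeo i).eta A) p : 𝔸) - 1‖ ≤ alphaW (sRead C Λ) * ((kGeo i).eta * lam⁻¹) ^ 2 := by
  have hη := (B9BackgroundsKLevelV1.eta_pos_L_one_le_M_pos i).1
  have hlam0 : 0 < lam := lt_of_lt_of_le hη hηl
  have hs := sRead_nonneg hC Λ
  obtain ⟨h4, h2⟩ := readings_at_scale i c hC hξ hΛ hξS hQ hA hdA hlam0 hlam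
  obtain ⟨x, μ, ν, hμν⟩ := p
  rw [locCfgY_eq_prodCfg]
  refine (norm_holY_prodCfg_sub_one_le i hη hηl (cutFldY i (chiTY i c) A) x hμν (h4 μ x) (h4 ν x) (h2 μ ν x) (h2 ν μ x)).trans ?_
  rw [div_eq_mul_inv]
  have ht : (kGeo i).eta * lam⁻¹ ≤ 1 := by rw [← div_eq_mul_inv, div_le_one hlam0]; exact hηl
  exact mul_le_mul_of_nonneg_right (exp_mul_le_alphaW hs ht) (sq_nonneg _)

omit hC hξ hΛ hξS hQ hA hdA in
/-- **BI-CONTRACTIVITY OF `Ṽ_□`** from the HERMITIAN TYPE of the datum's field (`‖e^{itA}‖ ≤ 1` for every real `t`; print: `U`, `u` are `G`-valued, so `A ∈ 𝔤` and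
`e^{iηχ̃A} ∈ G`): `‖Ṽ_κ(x)‖ ≤ 1` and `‖Ṽ_κ(x)⁻¹‖ ≤ 1` — the `hU` binder of G-F5a III ∕ the `UnitaryLike` binder of G-F5c. [cite: Balaban1985BackgroundPropagators, (3.35) p.396, Cor. 3.6 p.408] -/
theorem unitaryLike_locCfgY (hAu : ∀ (t : ℝ) (κ : Fin (d + 1)) (x : Site (PV d ℓ i.m i.K hd hL) 0), ‖NormedSpace.exp ((I * (t : ℂ)) • A κ x)‖ ≤ 1)
    (η : ℝ) (κ : Fin (d + 1)) (x : Site (PV d ℓ i.m i.K hd hL) 0) :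
    ‖(locCfgY i c η A κ x : 𝔸)‖ ≤ 1 ∧ ‖(((locCfgY i c η A κ x)⁻¹ : 𝔸ˣ) : 𝔸)‖ ≤ 1 := by
  rw [locCfgY_apply]
  have e1 : ((I * (η : ℂ))) • cutFldY i (chiTY i c) A κ x = (I * ((η * chiTY i c (boxEquiv i.hN x) : ℝ) : ℂ)) • A κ x := by
    change ((I * (η : ℂ))) • ((((chiTY i c (boxEquiv i.hN x)) : ℝ) : ℂ) • A κ x) = _
    rw [smul_smul]; push_cast; ring_nf
  constructor
  · rw [val_fluct, e1]; exact hAu _ κ x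
  · rw [val_inv_fluct, e1, ← neg_smul]
    have e2 : -(I * ((η * chiTY i c (boxEquiv i.hN x) : ℝ) : ℂ)) = I * ((-(η * chiTY i c (boxEquiv i.hN x)) : ℝ) : ℂ) := by push_cast; ring
    rw [e2]; exact hAu _ κ x

omit hC hξ hΛ hξS hQ hA hdA in
/-- the holonomy of a bi-contractive configuration is bi-contractive. [cite: Balaban1985BackgroundPropagators, (3.1) p.390, bookkeeping] -/
theorem unitaryLike_holY {V : CfgY 𝔸 i} (hU : ∀ μ x, ‖(V μ x : 𝔸)‖ ≤ 1 ∧ ‖(((V μ x)⁻¹ : 𝔸ˣ) : 𝔸)‖ ≤ 1) (p : PlaqY i) :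
    UnitaryLike (holY i V p) := by
  have h : ∀ μ x, UnitaryLike (V μ x) := fun μ x => (T4RelativeLadder.unitaryLike_iff _).2 (hU μ x)
  unfold holY
  exact ((T4RelativeLadder.UnitaryLike.mul (T4RelativeLadder.UnitaryLike.mul (h _ _) (h _ _)) (h _ _).inv).mul (h _ _).inv)

/-- ★ **(W3) FOR `Re` AND `Im` AT SCALE `λ`**, bi-contractive `Ṽ_□`: `‖Re Ṽ(∂p) − 1‖, ‖Im Ṽ(∂p)‖ ≤ α_W(s)(η∕λ)²`.
[cite: Balaban1985BackgroundPropagators, p.404 below (3.69), Cor. 3.6 p.408] -/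
theorem norm_reHolY_imHolY_locCfgY_le (hU : ∀ μ x, ‖(locCfgY i c (kGeo i).eta A μ x : 𝔸)‖ ≤ 1 ∧ ‖(((locCfgY i c (kGeo i).eta A μ x)⁻¹ : 𝔸ˣ) : 𝔸)‖ ≤ 1)
    {lam : ℝ} (hηl : (kGeo i).eta ≤ lam) (hlam : lam ≤ Λ * ξ) (p : PlaqY i) :
    ‖reHolY i (locCfgY i c (kGeo i).eta A) p - 1‖ ≤ alphaW (sRead C Λ) * ((kGeo i).eta * lam⁻¹) ^ 2 ∧
      ‖imHolY i (locCfgY i c (kGeo i).eta A) p‖ ≤ alphaW (sRead C Λ) * ((kGeo i).eta * lam⁻¹) ^ 2 := by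
  have hh := (T4RelativeLadder.unitaryLike_iff _).1 (unitaryLike_holY i hU p)
  have hw := norm_holY_locCfgY_sub_one_le i c hC hξ hΛ hξS hQ hA hdA hηl hlam p
  have hri := norm_reHolY_imHolY_le i (locCfgY i c (kGeo i).eta A) p hh.2
  exact ⟨hri.1.trans hw, hri.2.trans hw⟩

/-! ## §4  ★★★ The binders VERBATIM: `hW1`∕`hW2`∕`hW3` of G-F5a III and `hsm` of G-F5c at `V := Ṽ_□`, `α₁ := α_W(s)` -/

variable (hΛξ : LatticeNorms.scaleLen ((ℓ : ℝ) + 1) (kGeo i).eta (c.1.1 + 1) ≤ Λ * ξ)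
include hΛξ

omit hC hξ hΛ hξS hQ hA hdA in
/-- `η ≤ len(a) ≤ Λξ` for a cube block. [cite: Balaban1985BackgroundPropagators, (3.41) p.397, p.408, bookkeeping] -/
theorem len_bounds (a : BlkCubeY i c) : (kGeo i).eta ≤ (geoCK i c).len a ∧ (geoCK i c).len a ≤ Λ * ξ :=
  ⟨by rw [← geoCK_eta i c]; exact geoCK_eta_le_len i c a, (len_blkCubeY_le_scaleLen i c a).trans hΛξ⟩

/-- ★★★ **`hW1` AT `Ṽ_□`**: `‖Ṽ_{a′}(y) − 1‖ ≤ α_W(s)·η∕len(a)` for every cube block `a`, direction `a′` and torus site `y` (the `dSite ≤ 2` premise is not needed).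
[cite: Balaban1985BackgroundPropagators, Cor. 3.6 p.408, (3.37) p.396, (3.73) p.405] -/
theorem hW1_locCfgY [NormOneClass 𝔸] :
    ∀ (a : BlkCubeY i c) (a' : Fin (d + 1)) (y : Site (PV d ℓ i.m i.K hd hL) 0), dSite i c a y ≤ 2 →
      ‖(locCfgY i c (kGeo i).eta A a' y : 𝔸) - 1‖ ≤ alphaW (sRead C Λ) * ((kGeo i).eta * ((geoCK i c).len a)⁻¹) := by
  intro a a' y _
  obtain ⟨h1, h2⟩ := len_bounds i c hΛξ a
  refine (norm_locCfgY_sub_one_le i c hC hξ hΛ hξS hQ hA hdA h1 h2 a' y).trans ?_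
  exact mul_le_mul_of_nonneg_right (mul_exp_le_alphaW (sRead_nonneg hC Λ)) (by have := geoCK_len_pos i c a; have := (B9BackgroundsKLevelV1.eta_pos_L_one_le_M_pos i).1; positivity)

/-- ★★★ **`hW2` AT `Ṽ_□`**: `‖Ṽ_{a′}(y) − Ṽ_{a′}(y − e_μ)‖ ≤ α_W(s)·(η∕len(a))²`. [cite: Balaban1985BackgroundPropagators, Cor. 3.6 p.408, (3.37) p.396, (3.73) p.405] -/
theorem hW2_locCfgY [NormOneClass 𝔸] :
    ∀ (a : BlkCubeY i c) (a' μ : Fin (d + 1)) (y : Site (PV d ℓ i.m i.K hd hL) 0), dSite i c a y ≤ 2 →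
      ‖(locCfgY i c (kGeo i).eta A a' y : 𝔸) - locCfgY i c (kGeo i).eta A a' (y.unshift μ)‖ ≤
        alphaW (sRead C Λ) * ((kGeo i).eta * ((geoCK i c).len a)⁻¹) ^ 2 := by
  intro a a' μ y _
  obtain ⟨h1, h2⟩ := len_bounds i c hΛξ a
  refine (norm_locCfgY_sub_unshift_le i c hC hξ hΛ hξS hQ hA hdA h1 h2 a' μ y).trans ?_
  exact mul_le_mul_of_nonneg_right (mul_exp_le_alphaW (sRead_nonneg hC Λ)) (sq_nonneg _)

/-- ★★★ **`hW3` AT `Ṽ_□`** (bi-contractive `Ṽ_□`): `‖Re Ṽ(∂p) − 1‖, ‖Im Ṽ(∂p)‖ ≤ α_W(s)·(η∕len(a))²` for every cube block `a` and plaquette `p`.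
[cite: Balaban1985BackgroundPropagators, (3.69) p.404, Cor. 3.6 p.408] -/
theorem hW3_locCfgY (hU : ∀ μ x, ‖(locCfgY i c (kGeo i).eta A μ x : 𝔸)‖ ≤ 1 ∧ ‖(((locCfgY i c (kGeo i).eta A μ x)⁻¹ : 𝔸ˣ) : 𝔸)‖ ≤ 1) :
    ∀ (a : BlkCubeY i c) (p : PlaqY i), dSite i c a p.src ≤ 2 →
      ‖reHolY i (locCfgY i c (kGeo i).eta A) p - 1‖ ≤ alphaW (sRead C Λ) * ((kGeo i).eta * ((geoCK i c).len a)⁻¹) ^ 2 ∧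
        ‖imHolY i (locCfgY i c (kGeo i).eta A) p‖ ≤ alphaW (sRead C Λ) * ((kGeo i).eta * ((geoCK i c).len a)⁻¹) ^ 2 := by
  intro a p _
  obtain ⟨h1, h2⟩ := len_bounds i c hΛξ a
  exact norm_reHolY_imHolY_locCfgY_le i c hC hξ hΛ hξS hQ hA hdA hU h1 h2 p

/-- ★★★ **`hsm` AT `Ṽ_□`** (G-F5c's ι-centred level-by-level smallness): `‖Ṽ_ν(w) − 1‖ ≤ α_W(s)·L^{−J(ι)}` for every index bond `ι` of the cube sequence and every
torus site `w` (the support premise is not needed). [cite: Balaban1985BackgroundPropagators, (3.83) p.407, Cor. 3.6 p.408, (3.37) p.396] -/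
theorem hsm_locCfgY [NormOneClass 𝔸] :
    ∀ (ι : IBondCubeY i c) (ν : Fin (d + 1)) (w : Site (PV d ℓ i.m i.K hd hL) 0),
      LatticeFieldCalculus.supDist (embIter (ι.1.1 : ℕ) ι.1.2.src) w ≤ (d + 2) * ((ℓ + 1) ^ (ι.1.1 : ℕ) - 1) →
        ‖(locCfgY i c (kGeo i).eta A ν w : 𝔸) - 1‖ ≤ alphaW (sRead C Λ) * ((((ℓ + 1 : ℕ) : ℝ)) ^ (ι.1.1 : ℕ))⁻¹ := by
  intro ι ν w _
  have hη := (B9BackgroundsKLevelV1.eta_pos_L_one_le_M_pos i).1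
  obtain ⟨h1, h2⟩ := scaleLen_ibond_bounds i c hΛξ ι
  refine (norm_locCfgY_sub_one_le i c hC hξ hΛ hξS hQ hA hdA h1 h2 ν w).trans ?_
  have hL0 : (0 : ℝ) < (((ℓ + 1 : ℕ) : ℝ)) ^ (ι.1.1 : ℕ) := by positivity
  have e : (kGeo i).eta * ((((ℓ + 1 : ℕ) : ℝ)) ^ (ι.1.1 : ℕ) * (kGeo i).eta)⁻¹ = ((((ℓ + 1 : ℕ) : ℝ)) ^ (ι.1.1 : ℕ))⁻¹ := by
    rw [mul_inv, mul_left_comm, mul_inv_cancel₀ hη.ne', mul_one]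
  rw [e]
  exact mul_le_mul_of_nonneg_right (mul_exp_le_alphaW (sRead_nonneg hC Λ)) (inv_nonneg.2 hL0.le)

end Windows

/-! ## §5  ★★★ REALIFIED: the `hV1 ν`, `hV0`, `hAv` inputs of `cor35_G_cube_of_pieces` at `Ṽ_□` from the (3.35) cube datum -/

section Majorant

variable {𝔸 : Type} [NormedRing 𝔸] [NormedAlgebra ℂ 𝔸] [CompleteSpace 𝔸] [NormOneClass 𝔸]
variable {ιb : Type} [Fintype ιb] (b : Module.Basis ιb ℝ 𝔸)
variable (i : KIdx d ℓ hd hL b₀ b₁) (c : ↥(cubes (toKT i).D.toDomains))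
variable {A : AfldY 𝔸 i} {Q : Set (Site (PV d ℓ i.m i.K hd hL) 0)} {C ξ Λ : ℝ} (hC : 0 ≤ C) (hξ : 0 < ξ) (hΛ : 1 ≤ Λ)
    (hξS : ξ ≤ 5 * (SC i c : ℝ) * (kGeo i).eta) (hΛξ : LatticeNorms.scaleLen ((ℓ : ℝ) + 1) (kGeo i).eta (c.1.1 + 1) ≤ Λ * ξ)
    (hQ : ∀ x : Site (PV d ℓ i.m i.K hd hL) 0, NearC i c (35 * SC i c / 8 + 1) (boxEquiv i.hN x).1 → x ∈ Q)
    (hA : ∀ κ, ∀ x ∈ Q, ‖A κ x‖ ≤ C * ξ⁻¹)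
    (hdA : ∀ μ ν, ∀ x ∈ Q, ‖(((kGeo i).eta : ℂ)⁻¹) • covD (shiftsV1 (PV d ℓ i.m i.K hd hL)) (fun _ _ => (1 : 𝔸ˣ)) μ (A ν) x‖ ≤ C * (ξ ^ 2)⁻¹)
    (hAu : ∀ (t : ℝ) (κ : Fin (d + 1)) (x : Site (PV d ℓ i.m i.K hd hL) 0), ‖NormedSpace.exp ((I * (t : ℂ)) • A κ x)‖ ≤ 1)
    {M₂ : ℝ} (hM₂ : 0 ≤ M₂) (hrepr : ∀ (v : 𝔸) (j : ιb), |b.repr v j| ≤ M₂ * ‖v‖)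
include hC hξ hΛ hξS hΛξ hQ hA hdA hAu hM₂ hrepr

/-- ★★★ **`hV1 ν` OF `cor35_G_cube_of_pieces` AT `Ṽ_□` FROM THE (3.35) CUBE DATUM**: `conj b(V¹_ν(Ṽ_□)) ≺ (M₂Σ‖b_j‖)·c_{V1}(d)·e^{2δ}·α_W(s)·len(a)⁻¹·e^{−δd(a,a′)}`
over `toB6 (geoCK i □) Rr H`. [cite: Balaban1985BackgroundPropagators, (3.73) p.405, Cor. 3.6 p.408, (3.85) p.407; Balaban1984PropagatorsII, (2.51) p.232] -/
theorem hasMajorant_V1Y_locCfgY {δ : ℝ} (hδ : 0 ≤ δ) (Rr : ℝ) (H : Prop) (ν : Fin (d + 1)) :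
    HasMajorant (g := toB6 (geoCK i c) Rr H) (blkBK i c) (B9Eq352DivFormLetters.conj b ((V1Y i (locCfgY i c (kGeo i).eta A) ν).restrictScalars ℝ))
      (fun a a' => (M₂ * ∑ j, ‖b j‖) *
        (cV1 d * Real.exp (2 * δ) * alphaW (sRead C Λ) * ((geoCK i c).len a)⁻¹ * Real.exp (-(δ * (geoCK i c).dist a a')))) :=
  hasMajorant_V1Y i c b (unitaryLike_locCfgY i c hAu (kGeo i).eta) hM₂ hrepr (alphaW_nonneg (sRead_nonneg hC Λ))
    (hW1_locCfgY i c hC hξ hΛ hξS hQ hA hdA hΛξ) (fun a p hp => (hW3_locCfgY i c hC hξ hΛ hξS hQ hA hdA hΛξ (unitaryLike_locCfgY i c hAu (kGeo i).eta) a p hp).1)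
    hδ Rr H ν

/-- ★★★ **`hV0` OF `cor35_G_cube_of_pieces` AT `Ṽ_□` FROM THE (3.35) CUBE DATUM**, under the smallness `α_W(s) ≤ 1` («O(1)Mα₀ sufficiently small»):
`conj b(V⁰(Ṽ_□)) ≺ (M₂Σ‖b_j‖)·c_{V0}(d)·e^{2δ}·α_W(s)·(len(a)²)⁻¹·e^{−δd(a,a′)}` over `toB6 (geoCK i □) Rr H`.
[cite: Balaban1985BackgroundPropagators, (3.73) p.405, (3.69) p.404, Cor. 3.6 p.408, (3.85) p.407; Balaban1984PropagatorsII, (2.51) p.232] -/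
theorem hasMajorant_V0Y_locCfgY (hsmall : alphaW (sRead C Λ) ≤ 1) {δ : ℝ} (hδ : 0 ≤ δ) (Rr : ℝ) (H : Prop) :
    HasMajorant (g := toB6 (geoCK i c) Rr H) (blkBK i c) (B9Eq352DivFormLetters.conj b ((V0Y i (locCfgY i c (kGeo i).eta A)).restrictScalars ℝ))
      (fun a a' => (M₂ * ∑ j, ‖b j‖) *
        (cV0 d * Real.exp (2 * δ) * alphaW (sRead C Λ) * ((geoCK i c).len a ^ 2)⁻¹ * Real.exp (-(δ * (geoCK i c).dist a a')))) :=
  hasMajorant_V0Y i c b (unitaryLike_locCfgY i c hAu (kGeo i).eta) hM₂ hrepr (alphaW_nonneg (sRead_nonneg hC Λ)) hsmall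
    (hW1_locCfgY i c hC hξ hΛ hξS hQ hA hdA hΛξ) (hW2_locCfgY i c hC hξ hΛ hξS hQ hA hdA hΛξ)
    (hW3_locCfgY i c hC hξ hΛ hξS hQ hA hdA hΛξ (unitaryLike_locCfgY i c hAu (kGeo i).eta)) hδ Rr H

/-- ★★★ **`hAv` OF `cor35_G_cube_of_pieces` AT `Ṽ_□` FROM THE (3.35) CUBE DATUM** (G-F5c's `hasMajorant_avgPieceK` fed with `hsm_locCfgY`):
`avgPieceK b i □ Ṽ_□ ≺ (M₂Σ‖b_j‖)·κ_av(d, L, b₁, α_W(s), δ)·(len(a)²)⁻¹·e^{−δd(a,a′)}` over `toB6 (geoCK i □) Rr H`.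
[cite: Balaban1985BackgroundPropagators, (3.83) p.407, Cor. 3.6 p.408, (3.85) p.407; Balaban1984PropagatorsII, (2.51) p.232] -/
theorem hasMajorant_avgPieceK_locCfgY (hb₀ : 0 < b₀) (hb₁ : b₀ ≤ b₁) {δ : ℝ} (hδ : 0 ≤ δ) (Rr : ℝ) (H : Prop) :
    HasMajorant (g := toB6 (geoCK i c) Rr H) (blkBK i c) (avgPieceK b i c (locCfgY i c (kGeo i).eta A))
      (fun a a' => (M₂ * ∑ j, ‖b j‖) *
        (kappaAv d ℓ b₁ (alphaW (sRead C Λ)) δ * ((geoCK i c).len a ^ 2)⁻¹ * Real.exp (-(δ * (geoCK i c).dist a a')))) :=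
  hasMajorant_avgPieceK b i c hb₀ hb₁ hM₂ hrepr (fun μ x => (T4RelativeLadder.unitaryLike_iff _).2 (unitaryLike_locCfgY i c hAu (kGeo i).eta μ x))
    (alphaW_nonneg (sRead_nonneg hC Λ)) (hsm_locCfgY i c hC hξ hΛ hξS hQ hA hdA hΛξ) hδ Rr H

end Majorant

end Literature.MathematicalPhysics.QuantumFieldTheory.Balaban1983to89.B9Cor36GCubeWindows

end
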